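import Summits.QuantumFields.BalabanUV.T4Continuum.Support.NE3CoarseInterpolant
import Summits.QuantumFields.BalabanUV.T4Continuum.Support.NE3TangentFlatStructure
import HarnessLib

/-!
# T⁴ programme, node NE3 — row E-MLw-(w4)-P, flat route H3, file 2: THE INTERPOLANT IN THE EXACT SHAPE OF THE ASSEMBLY SOCKET
# (`NE3SlicePoincareAssembly.sum_norm_sq_le_of_split_interp_frame`, hypotheses `hI`, `hIc`, `hIe` with `CI = 2^{d−1}`)

NE3 (node U1b) formalisation swarm, leaf seat `b2b-balaban-t4-ne3-formalise-leaf-01` (gen 5), row **H3** (ρ-g21-4 (W4), ρ-g22-1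
(R2)(R4)); sequel of `NE3CoarseInterpolant` (p226037).  The owner's H5a socket (p226117) takes a site field `I` with
(hI) `I` `(L^k·N)`-periodic, (hIc) `I ((L^k)•z) = −(framePot L k η z − ζ ((L:ℤ)^k • z))`, (hIe) `Σ‖dPot I‖² ≤ CI·((L^k)^d∕(L^k)²)·Σ_z Σ_κ
‖dPot (that datum) z κ‖²`.  THIS FILE produces such an `I` — the multilinear interpolant of the datum — with **`CI = 2^(d−1)`**, for ANY
`(L^k·N)`-periodic `η` and `ζ` (values in a real normed algebra `𝔸`: `ℂ` for H5a, matrices for H5b), so that H5b applies H5a per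
entry with no glue: `exists_interp_socket`.  0 sorry, 0 def.

HONEST FRAMING.  Pure lattice calculus; nothing about Bałaban's minimisers; (P♮), (ML_w) at W ≠ 1, T-E_w and **NE3 are NOT
proved**; spine PROVED 0∕9; finite T⁴ rung (B)+1 — NOT infinite volume, NOT mass gap, NOT `BetaPertH`, NOT Clay.  PLACEMENT:
`Summits/QuantumFields/BalabanUV/`.  HONEST DEPENDENCY (cell page 1): continuum YM on T⁴ ⇐ BetaPertH ∧ nine spine estimates
(0/9 proved); BetaPertH ⇐ (D1) ∧ (D4) ∧ CAP+tail; G-an2-4 gates asym, D1 and NE2/3/4.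
-/

set_option autoImplicit false

open scoped BigOperators
open Finset

namespace Summit.QuantumFields.BalabanUV.T4Continuum.NE3CoarseInterpolantSocket

open Literature.MathematicalPhysics.QuantumFieldTheory.Balaban1983to89
open B7Prop1Explicit
open T4AveragingDeficitWallBoundary (periodBox)
open NE3TangentNoGoWords (dPot)
open NE3TangentFlatStructure (framePot framePot_add_period)
open NE3CoarseInterpolant (interp_corner interp_add_period sum_normSq_dPot_interp_le)
open SmoothRefineInterp (interp)

noncomputable section

variable {d : ℕ}
variable {𝔸 : Type*} [NormedRing 𝔸] [NormedAlgebra ℂ 𝔸]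

/-- THE DATUM of the socket, `z ↦ −(framePot L k η z − ζ ((L:ℤ)^k • z))`, is `N`-periodic when `η`, `ζ` are `(L^k·N)`-periodic. [folklore] -/
theorem datum_add_period {L : ℕ} (k : ℕ) {N : ℕ} {η : Site d → Fin d → 𝔸} {ζ : Site d → 𝔸}
    (hη : ∀ (x : Site d) (τ μ : Fin d), η (x + ((L ^ k * N : ℕ) : ℤ) • e τ) μ = η x μ)
    (hζ : ∀ (x : Site d) (τ : Fin d), ζ (x + ((L ^ k * N : ℕ) : ℤ) • e τ) = ζ x) (z : Site d) (τ : Fin d) :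
    (fun w : Site d => -(framePot L k η w - ζ (((L : ℤ) ^ k) • w))) (z + (N : ℤ) • e τ)
      = (fun w : Site d => -(framePot L k η w - ζ (((L : ℤ) ^ k) • w))) z := by
  have hP : ((L ^ k * N : ℕ) : ℤ) = (L : ℤ) ^ k * (N : ℤ) := by push_cast; ring
  have hη' : ∀ (y : Site d) (τ' μ : Fin d), η (y + ((L : ℤ) ^ k * (N : ℤ)) • e τ') μ = η y μ := by
    intro y τ' μ; rw [← hP]; exact hη y τ' μ
  have hζ' : ζ (((L : ℤ) ^ k) • (z + (N : ℤ) • e τ)) = ζ (((L : ℤ) ^ k) • z) := by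
    rw [smul_add, smul_smul, ← hP, hζ]
  simp only [framePot_add_period L k η hη' z τ, hζ']

/-- **THE INTERPOLANT IN SOCKET SHAPE** (`CI = 2^{d−1}`): `L, N ≥ 1`, any `k`; for `(L^k·N)`-periodic `η`, `ζ` the site field
`I := interp (L^k) univ (fun w => −(framePot L k η w − ζ ((L:ℤ)^k • w)))` is `(L^k·N)`-periodic, takes the datum's values on the
corners `(L^k)•z`, and has Dirichlet energy over `periodBox (L^k·N)` at most `2^(d−1)·((L^k)^d∕(L^k)²)·` the datum's over
`periodBox N` — the hypotheses `hI`, `hIc`, `hIe` of `NE3SlicePoincareAssembly.sum_norm_sq_le_of_split_interp_frame` verbatim. [folklore] -/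
theorem exists_interp_socket {L : ℕ} (hL : 1 ≤ L) {N : ℕ} (hN : 1 ≤ N) (k : ℕ) (η : Site d → Fin d → 𝔸) (ζ : Site d → 𝔸)
    (hη : ∀ (x : Site d) (τ μ : Fin d), η (x + ((L ^ k * N : ℕ) : ℤ) • e τ) μ = η x μ)
    (hζ : ∀ (x : Site d) (τ : Fin d), ζ (x + ((L ^ k * N : ℕ) : ℤ) • e τ) = ζ x) :
    ∃ I : Site d → 𝔸,
      (∀ (x : Site d) (τ : Fin d), I (x + ((L ^ k * N : ℕ) : ℤ) • e τ) = I x) ∧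
      (∀ z : Site d, I (((L ^ k : ℕ) : ℤ) • z) = -(framePot L k η z - ζ (((L : ℤ) ^ k) • z))) ∧
      ∑ x ∈ periodBox (d := d) (L ^ k * N), ∑ κ : Fin d, ‖dPot I x κ‖ ^ 2
        ≤ (2 : ℝ) ^ (d - 1) * ((((L ^ k : ℕ) : ℝ)) ^ d / (((L ^ k : ℕ) : ℝ)) ^ 2)
          * ∑ z ∈ periodBox (d := d) N, ∑ κ : Fin d, ‖dPot (fun w => -(framePot L k η w - ζ (((L : ℤ) ^ k) • w))) z κ‖ ^ 2 := by
  have hM : 1 ≤ L ^ k := Nat.one_le_pow _ _ hL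
  have hm := datum_add_period (d := d) (𝔸 := 𝔸) k hη hζ
  refine ⟨interp (L ^ k) Finset.univ (fun w => -(framePot L k η w - ζ (((L : ℤ) ^ k) • w))),
    fun x τ => interp_add_period hM Finset.univ hm x τ, fun z => interp_corner hM Finset.univ _ z, ?_⟩
  exact sum_normSq_dPot_interp_le hM hN hm

end

end Summit.QuantumFields.BalabanUV.T4Continuum.NE3CoarseInterpolantSocket
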